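import Summits.QuantumFields.YangMills.Theorems.SandwichVariancePinchingGaussianVarianceNonneg
import Summits.QuantumFields.YangMills.Theorems.SandwichVariancePinchingSandwichMomentsLtOne

/-!
# Route `SandwichVariancePinching` — the line's composition REPAIRED: the `LogConcaveChart` crux
# `QuadraticCovarianceComparison` (stmt-QuantumFields-26240) from the two variance pinchings ALONE

The route's certified deciding theorem `Theses.SandwichVariancePinching.closes h1 h2 hS hN` consumes, besides the two cruxes
`QuadraticVarianceCeiling` (28259) / `QuadraticVarianceFloor` (28260), the supports `SandwichMoments` (28261) and `GaussianVarianceNonneg`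
(28262).  The latter is proved (`sandwichVariancePinching_gaussianVarianceNonneg_proof`); the former is FALSE as filed at `δ = 1`
(`not_SandwichMoments`) but its repair with `δ < 1` is proved (`SandwichVariancePinching.sandwichMoments_of_lt_one`).  This file re-runs
the planner's polarisation + scaling argument (the body of `closes`, planner ym-idea-3 g12, copied with three changes: the comparison
radius is capped at `δ₀ = min δ₁ δ₂ ½ < 1`, the moments come from the repaired support, and `GaussianVarianceNonneg` is the landed
theorem) and obtains

`quadraticCovarianceComparison_of_pinchings : QuadraticVarianceCeiling → QuadraticVarianceFloor → LogConcaveChart.QuadraticCovarianceComparison`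

— so the open content of the sub-line is EXACTLY its two cruxes.  Mathematics of the composition: polarisation `u = t·f + t⁻¹·g`,
`w = t·f − t⁻¹·g` (`Cov = [Var u − Var w]/4`, `rC = [rV_u − rV_w]/4`, `rV_u + rV_w = 2(t²rV_f + t⁻²rV_g)`) and the scaling
`t² = √(rV_g/rV_f)` (degenerate `rV = 0` cases by `t → ∞` / `t → 0`). [folklore]

HONEST SCOPE.  A conditional reduction: both cruxes, the target crux 26240, route `LogConcaveChart`, rung R2a and every summit statement
stay open; nothing here bears on the Yang–Mills mass gap.
-/

noncomputable section

namespace Summit.QuantumFields.YangMills.Theorems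

namespace SandwichVariancePinching

open MeasureTheory
open scoped Matrix
open Summit.QuantumFields.YangMills.Theses.SandwichVariancePinching

/-- **`QuadraticVarianceCeiling → QuadraticVarianceFloor → LogConcaveChart.QuadraticCovarianceComparison`** — the sub-line's composition
with both routine supports DISCHARGED (`GaussianVarianceNonneg` proved; `SandwichMoments` replaced by its proved repair with `δ < 1`, the
radius being capped at `min δ₁ δ₂ ½`).  Body: the planner's certified polarisation/scaling proof of `closes`, verbatim up to those inputs.
[folklore] -/
theorem quadraticCovarianceComparison_of_pinchings (h1 : QuadraticVarianceCeiling) (h2 : QuadraticVarianceFloor) :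
    Summit.QuantumFields.YangMills.Theses.LogConcaveChart.QuadraticCovarianceComparison := by
  have hN : GaussianVarianceNonneg := sandwichVariancePinching_gaussianVarianceNonneg_proof
  have hlim : ∀ {X K : ℝ}, 0 ≤ K → (∀ s : ℝ, 0 < s → X ≤ K / s) → X ≤ 0 := by
    intro X K hK h
    by_contra hX
    push Not at hX
    have hs : 0 < 2 * (K + 1) / X := by positivity
    have h1 := h (2 * (K + 1) / X) hs
    have h2 : K / (2 * (K + 1) / X) = X * (K / (2 * (K + 1))) := by field_simp
    have h3 : K / (2 * (K + 1)) ≤ 1 / 2 := by rw [div_le_iff₀ (by positivity)]; linarith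
    rw [h2] at h1
    nlinarith
  obtain ⟨C1, δ1, hC1, hδ1, hδ1', H1⟩ := h1
  obtain ⟨C2, δ2, hC2, hδ2, hδ2', H2⟩ := h2
  refine ⟨max C1 C2, min (min δ1 δ2) (1 / 2), lt_min (lt_min hδ1 hδ2) one_half_pos,
    le_trans (min_le_left _ _) (le_trans (min_le_left _ _) hδ1'), ?_⟩
  intro δ hδ hδle n H₀ Hf Hg bf bg A hH₀ hHf hHg hA hsw hmean
  dsimp only
  have hδ1le : δ ≤ δ1 := le_trans hδle (le_trans (min_le_left _ _) (min_le_left _ _))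
  have hδ2le : δ ≤ δ2 := le_trans hδle (le_trans (min_le_left _ _) (min_le_right _ _))
  have hδlt1 : δ < 1 := lt_of_le_of_lt (le_trans hδle (min_le_right _ _)) (by norm_num)
  obtain ⟨-, hZpos, hImom⟩ := sandwichMoments_of_lt_one δ hδ hδlt1 n H₀ A hH₀ hA hsw
  have hCm : C1 ≤ max C1 C2 ∧ C2 ≤ max C1 C2 := ⟨le_max_left _ _, le_max_right _ _⟩
  have hCm0 : 0 ≤ max C1 C2 := le_trans hC1 hCm.1
  set E : (Fin n → ℝ) → ℝ := fun x => Real.exp (-A x) with hE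
  set F : (Fin n → ℝ) → ℝ := fun x => x ⬝ᵥ Hf.mulVec x + bf ⬝ᵥ x with hF
  set G : (Fin n → ℝ) → ℝ := fun x => x ⬝ᵥ Hg.mulVec x + bg ⬝ᵥ x with hG
  have eE : ∀ x, Real.exp (-A x) = E x := fun x => rfl
  have eF : ∀ x, x ⬝ᵥ Hf.mulVec x + bf ⬝ᵥ x = F x := fun x => rfl
  have eG : ∀ x, x ⬝ᵥ Hg.mulVec x + bg ⬝ᵥ x = G x := fun x => rfl
  simp only [eE, eF, eG]
  set Z : ℝ := ∫ x, E x with hZ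
  set If : ℝ := ∫ x, F x * E x
  set Ig : ℝ := ∫ x, G x * E x
  set Ifg : ℝ := ∫ x, F x * G x * E x
  set Iff : ℝ := ∫ x, F x * F x * E x
  set Igg : ℝ := ∫ x, G x * G x * E x
  set rC : ℝ := 2 * (H₀⁻¹ * Hf * H₀⁻¹ * Hg).trace + bf ⬝ᵥ H₀⁻¹.mulVec bg with hrC
  set rVf : ℝ := 2 * (H₀⁻¹ * Hf * H₀⁻¹ * Hf).trace + bf ⬝ᵥ H₀⁻¹.mulVec bf with hrVf
  set rVg : ℝ := 2 * (H₀⁻¹ * Hg * H₀⁻¹ * Hg).trace + bg ⬝ᵥ H₀⁻¹.mulVec bg with hrVg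
  have hZne : Z ≠ 0 := ne_of_gt hZpos
  have iF : MeasureTheory.Integrable (fun x => F x * E x) := (hImom Hf Hf bf bf).1
  have iG : MeasureTheory.Integrable (fun x => G x * E x) := (hImom Hg Hg bg bg).1
  have iFF : MeasureTheory.Integrable (fun x => F x * F x * E x) := (hImom Hf Hf bf bf).2
  have iFG : MeasureTheory.Integrable (fun x => F x * G x * E x) := (hImom Hf Hg bf bg).2
  have iGG : MeasureTheory.Integrable (fun x => G x * G x * E x) := (hImom Hg Hg bg bg).2
  have hrVf0 : 0 ≤ rVf := hN n H₀ Hf bf hH₀ hHf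
  have hrVg0 : 0 ≤ rVg := hN n H₀ Hg bg hH₀ hHg
  have hH₀invT : (H₀⁻¹)ᵀ = H₀⁻¹ := by
    have h := hH₀.1.inv
    unfold Matrix.IsHermitian at h
    rwa [Matrix.conjTranspose_eq_transpose_of_trivial] at h
  have htr : (H₀⁻¹ * Hg * H₀⁻¹ * Hf).trace = (H₀⁻¹ * Hf * H₀⁻¹ * Hg).trace := by
    rw [Matrix.mul_assoc (H₀⁻¹ * Hg) H₀⁻¹ Hf, Matrix.trace_mul_comm, ← Matrix.mul_assoc]
  have hbsym : bg ⬝ᵥ H₀⁻¹.mulVec bf = bf ⬝ᵥ H₀⁻¹.mulVec bg := by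
    rw [Matrix.dotProduct_mulVec, ← Matrix.mulVec_transpose, hH₀invT, dotProduct_comm]
  have key : ∀ t : ℝ, 0 < t →
      |(Ifg / Z - (If / Z) * (Ig / Z)) - rC| ≤ (max C1 C2 * δ / 2) * (t ^ 2 * rVf + t⁻¹ ^ 2 * rVg) := by
    intro t ht
    have ht0 : t ≠ 0 := ne_of_gt ht
    have main : ∀ s : ℝ, s = t⁻¹ ∨ s = -t⁻¹ →
        (1 - C2 * δ) * (t ^ 2 * rVf + 2 * (t * s) * rC + s ^ 2 * rVg) ≤
          (t ^ 2 * Iff + 2 * (t * s) * Ifg + s ^ 2 * Igg) / Z - (t * If + s * Ig) / Z * ((t * If + s * Ig) / Z) ∧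
        (t ^ 2 * Iff + 2 * (t * s) * Ifg + s ^ 2 * Igg) / Z - (t * If + s * Ig) / Z * ((t * If + s * Ig) / Z) ≤
          (1 + C1 * δ) * (t ^ 2 * rVf + 2 * (t * s) * rC + s ^ 2 * rVg) ∧
        0 ≤ t ^ 2 * rVf + 2 * (t * s) * rC + s ^ 2 * rVg := by
      intro s _
      set Hu : Matrix (Fin n) (Fin n) ℝ := t • Hf + s • Hg with hHu
      set bu : Fin n → ℝ := t • bf + s • bg with hbu
      have hHu_s : Hu.IsSymm := (hHf.smul t).add (hHg.smul s)
      have hqu : ∀ x : Fin n → ℝ, x ⬝ᵥ Hu.mulVec x + bu ⬝ᵥ x = t * F x + s * G x := by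
        intro x
        simp only [hHu, hbu, hF, hG, Matrix.add_mulVec, Matrix.smul_mulVec, dotProduct_add, dotProduct_smul,
          add_dotProduct, smul_dotProduct, smul_eq_mul]
        ring
      have i1 : MeasureTheory.Integrable (fun x => t * (F x * E x)) := iF.const_mul t
      have i2 : MeasureTheory.Integrable (fun x => s * (G x * E x)) := iG.const_mul s
      have hI1 : ∫ x, (x ⬝ᵥ Hu.mulVec x + bu ⬝ᵥ x) * E x = t * If + s * Ig := by
        have : (fun x => (x ⬝ᵥ Hu.mulVec x + bu ⬝ᵥ x) * E x) = fun x => t * (F x * E x) + s * (G x * E x) := by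
          funext x; rw [hqu x]; ring
        rw [this, MeasureTheory.integral_add i1 i2, MeasureTheory.integral_const_mul, MeasureTheory.integral_const_mul]
      have j1 : MeasureTheory.Integrable (fun x => t ^ 2 * (F x * F x * E x)) := iFF.const_mul _
      have j2 : MeasureTheory.Integrable (fun x => 2 * (t * s) * (F x * G x * E x)) := iFG.const_mul _
      have j3 : MeasureTheory.Integrable (fun x => s ^ 2 * (G x * G x * E x)) := iGG.const_mul _
      have j12 : MeasureTheory.Integrable (fun x => t ^ 2 * (F x * F x * E x) + 2 * (t * s) * (F x * G x * E x)) :=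
        j1.add j2
      have hI2 : ∫ x, (x ⬝ᵥ Hu.mulVec x + bu ⬝ᵥ x) * (x ⬝ᵥ Hu.mulVec x + bu ⬝ᵥ x) * E x =
          t ^ 2 * Iff + 2 * (t * s) * Ifg + s ^ 2 * Igg := by
        have : (fun x => (x ⬝ᵥ Hu.mulVec x + bu ⬝ᵥ x) * (x ⬝ᵥ Hu.mulVec x + bu ⬝ᵥ x) * E x) =
            fun x => t ^ 2 * (F x * F x * E x) + 2 * (t * s) * (F x * G x * E x) + s ^ 2 * (G x * G x * E x) := by
          funext x; rw [hqu x]; ring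
        rw [this, MeasureTheory.integral_add j12 j3, MeasureTheory.integral_add j1 j2, MeasureTheory.integral_const_mul,
          MeasureTheory.integral_const_mul, MeasureTheory.integral_const_mul]
      have hrVu : 2 * (H₀⁻¹ * Hu * H₀⁻¹ * Hu).trace + bu ⬝ᵥ H₀⁻¹.mulVec bu =
          t ^ 2 * rVf + 2 * (t * s) * rC + s ^ 2 * rVg := by
        simp only [hHu, hbu, hrVf, hrVg, hrC, Matrix.mul_add, Matrix.add_mul, Matrix.mul_smul, Matrix.smul_mul,
          Matrix.trace_add, Matrix.trace_smul, smul_eq_mul, Matrix.mulVec_add, Matrix.mulVec_smul, dotProduct_add,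
          dotProduct_smul, add_dotProduct, smul_dotProduct, htr, hbsym]
        ring
      have hu1 := H1 δ hδ hδ1le n H₀ Hu bu A hH₀ hHu_s hA hsw hmean
      have hu2 := H2 δ hδ hδ2le n H₀ Hu bu A hH₀ hHu_s hA hsw hmean
      dsimp only at hu1 hu2
      simp only [eE] at hu1 hu2
      rw [hI2, hI1, hrVu] at hu1 hu2
      exact ⟨hu2, hu1, by rw [← hrVu]; exact hN n H₀ Hu bu hH₀ hHu_s⟩
    obtain ⟨hu2, hu1, hRu0⟩ := main t⁻¹ (Or.inl rfl)
    obtain ⟨hw2, hw1, hRw0⟩ := main (-t⁻¹) (Or.inr rfl)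
    have htt : t * t⁻¹ = 1 := mul_inv_cancel₀ ht0
    set Ru : ℝ := t ^ 2 * rVf + 2 * (t * t⁻¹) * rC + t⁻¹ ^ 2 * rVg with hRu
    set Rw : ℝ := t ^ 2 * rVf + 2 * (t * -t⁻¹) * rC + (-t⁻¹) ^ 2 * rVg with hRw
    have e1 : C1 * δ * Ru ≤ max C1 C2 * δ * Ru :=
      mul_le_mul_of_nonneg_right (mul_le_mul_of_nonneg_right hCm.1 hδ) hRu0
    have e2 : C2 * δ * Ru ≤ max C1 C2 * δ * Ru :=
      mul_le_mul_of_nonneg_right (mul_le_mul_of_nonneg_right hCm.2 hδ) hRu0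
    have e3 : C1 * δ * Rw ≤ max C1 C2 * δ * Rw :=
      mul_le_mul_of_nonneg_right (mul_le_mul_of_nonneg_right hCm.1 hδ) hRw0
    have e4 : C2 * δ * Rw ≤ max C1 C2 * δ * Rw :=
      mul_le_mul_of_nonneg_right (mul_le_mul_of_nonneg_right hCm.2 hδ) hRw0
    have hcov : Ifg / Z - (If / Z) * (Ig / Z) =
        (((t ^ 2 * Iff + 2 * (t * t⁻¹) * Ifg + t⁻¹ ^ 2 * Igg) / Z - (t * If + t⁻¹ * Ig) / Z * ((t * If + t⁻¹ * Ig) / Z))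
          - ((t ^ 2 * Iff + 2 * (t * -t⁻¹) * Ifg + (-t⁻¹) ^ 2 * Igg) / Z
              - (t * If + -t⁻¹ * Ig) / Z * ((t * If + -t⁻¹ * Ig) / Z))) / 4 := by
      rw [htt]; field_simp; ring
    have hR1 : rC = (Ru - Rw) / 4 := by rw [hRu, hRw]; field_simp; ring
    have hR2 : t ^ 2 * rVf + t⁻¹ ^ 2 * rVg = (Ru + Rw) / 2 := by rw [hRu, hRw]; ring
    rw [hcov, hR1, hR2, abs_le]
    constructor
    · linarith [hu1, hu2, hw1, hw2, e1, e2, e3, e4]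
    · linarith [hu1, hu2, hw1, hw2, e1, e2, e3, e4]
  rcases eq_or_lt_of_le hrVf0 with hf0 | hfpos
  · have hsq : Real.sqrt (rVf * rVg) = 0 := by rw [← hf0]; simp
    rw [hsq, mul_zero]
    refine hlim (K := (max C1 C2 * δ / 2) * rVg) (by positivity) fun s hs => ?_
    have hks := key (Real.sqrt s) (Real.sqrt_pos.mpr hs)
    rw [← hf0, mul_zero, zero_add, inv_pow, Real.sq_sqrt hs.le] at hks
    calc _ ≤ (max C1 C2 * δ / 2) * (s⁻¹ * rVg) := hks
      _ = (max C1 C2 * δ / 2) * rVg / s := by field_simp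
  rcases eq_or_lt_of_le hrVg0 with hg0 | hgpos
  · have hsq : Real.sqrt (rVf * rVg) = 0 := by rw [← hg0]; simp
    rw [hsq, mul_zero]
    refine hlim (K := (max C1 C2 * δ / 2) * rVf) (by positivity) fun s hs => ?_
    have hks := key ((Real.sqrt s)⁻¹) (inv_pos.mpr (Real.sqrt_pos.mpr hs))
    rw [← hg0, mul_zero, add_zero, inv_pow, Real.sq_sqrt hs.le] at hks
    calc _ ≤ (max C1 C2 * δ / 2) * (s⁻¹ * rVf) := hks
      _ = (max C1 C2 * δ / 2) * rVf / s := by field_simp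
  have hsf : 0 < Real.sqrt rVf := Real.sqrt_pos.mpr hfpos
  have hsg : 0 < Real.sqrt rVg := Real.sqrt_pos.mpr hgpos
  have hmain := key (Real.sqrt (Real.sqrt rVg / Real.sqrt rVf)) (Real.sqrt_pos.mpr (div_pos hsg hsf))
  have ht2 : Real.sqrt (Real.sqrt rVg / Real.sqrt rVf) ^ 2 = Real.sqrt rVg / Real.sqrt rVf :=
    Real.sq_sqrt (div_pos hsg hsf).le
  have hff : Real.sqrt rVf * Real.sqrt rVf = rVf := Real.mul_self_sqrt hrVf0
  have hgg : Real.sqrt rVg * Real.sqrt rVg = rVg := Real.mul_self_sqrt hrVg0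
  have h1' : Real.sqrt (Real.sqrt rVg / Real.sqrt rVf) ^ 2 * rVf = Real.sqrt rVf * Real.sqrt rVg := by
    rw [ht2]
    have hh : Real.sqrt rVg / Real.sqrt rVf * rVf =
        Real.sqrt rVg / Real.sqrt rVf * (Real.sqrt rVf * Real.sqrt rVf) := by rw [hff]
    rw [hh]; field_simp
  have h2' : (Real.sqrt (Real.sqrt rVg / Real.sqrt rVf))⁻¹ ^ 2 * rVg = Real.sqrt rVf * Real.sqrt rVg := by
    rw [inv_pow, ht2, inv_div]
    have hh : Real.sqrt rVf / Real.sqrt rVg * rVg =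
        Real.sqrt rVf / Real.sqrt rVg * (Real.sqrt rVg * Real.sqrt rVg) := by rw [hgg]
    rw [hh]; field_simp
  rw [h1', h2'] at hmain
  rw [Real.sqrt_mul hrVf0]
  linarith


end SandwichVariancePinching

end Summit.QuantumFields.YangMills.Theorems

end
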